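import Summits.KontsevichZagierPeriods.KontsevichZagierPeriods.Theorems.SymplecticScissorsRealOnePeriodRelationsStubCellGreenAux
import Mathlib.Analysis.Complex.HasPrimitives
import Mathlib.Analysis.Analytic.Polynomial

/-!
# `RealOnePeriodRelations`, line `nash-retraction-thin-strip`, stub `stub_cellGreen` — auxiliary file 2

Calculus of the bilinear Coons patch `P` of a chart cell (four `ℚ`-semialgebraic `C¹` chart paths
`wb, wr, wt, wl : [0,1] → closedBall c (ρ/4)` with matching corners; `P, ∂ᵤP, ∂ᵥP` are given through
characterising hypotheses `hP, hPu, hPv`, no definitions): `P` maps the closed unit square into `ball c ρ`;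
its Fréchet derivative on the open square is `x ↦ x₀·∂ᵤP + x₁·∂ᵥP`; `P, ∂ᵤP, ∂ᵥP` are `ℚ`-semialgebraic
(realified) and continuous on the CLOSED square; for a chart `ψ` holomorphic on `ball c ε` and semialgebraic
on `closedBall c ρ` the density `g = Σᵢ ωᵢ(ψ) ψᵢ′` of the pulled-back form is analytic on the ball
(registered anchor `helper_cellGreen_2`) and `g ∘ P` is `ℚ`-semialgebraic on the square.

References: M. Kontsevich, D. Zagier, *Periods* (2001), §1.2; J. Bochnak, M. Coste, M.-F. Roy, *Real Algebraic
Geometry* (1998), §2.2; S. Basu, R. Pollack, M.-F. Roy, *Algorithms in Real Algebraic Geometry* (2006), Prop. 3.22.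
-/

noncomputable section

open scoped BigOperators Topology
open Set Filter Metric
open Literature.NumberTheory.Transcendental Literature.NumberTheory.Transcendental.CurvePeriods
open Literature.ModelTheory.ExponentialFields (IsSemialgebraic isSemialgebraic_interior)
open Summit.KontsevichZagierPeriods.Theorems.StuffleInKZ.Negative.LogShadow (isSemialgebraic_Icc01)
open Summit.KontsevichZagierPeriods.SymplecticScissors.RealOnePeriodRelations.HomotopyInvariance
  (re_im_finsetSum re_im_eval)

namespace Summit.KontsevichZagierPeriods.SymplecticScissors.RealOnePeriodRelations.CellGreen

/-- **The density of a pulled-back polynomial form along a holomorphic chart is analytic**: for `ψ`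
holomorphic on `ball c ε`, `w ↦ Σᵢ ωᵢ(ψ(w)) · ψᵢ′(w)` is analytic there. [folklore] -/
theorem analyticOnNhd_density {n : ℕ} (ω : Fin n → MvPolynomial (Fin n) ℂ) {c : ℂ} {ε : ℝ}
    {ψ : ℂ → (Fin n → ℂ)} (hψ : AnalyticOnNhd ℂ ψ (ball c ε)) :
    AnalyticOnNhd ℂ (fun w => ∑ i, MvPolynomial.eval (ψ w) (ω i) * deriv (fun u => ψ u i) w) (ball c ε) := by
  have hψi : ∀ i, AnalyticOnNhd ℂ (fun u => ψ u i) (ball c ε) :=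
    fun i w hw => (analyticAt_pi_iff (f := fun j u => ψ u j)).1 (hψ w hw) i
  have heval : ∀ i, AnalyticOnNhd ℂ (fun w => MvPolynomial.eval (ψ w) (ω i)) (ball c ε) := by
    intro i
    simpa using AnalyticOnNhd.aeval_mvPolynomial (f := fun w j => ψ w j) (fun j => hψi j) (ω i)
  exact Finset.analyticOnNhd_fun_sum Finset.univ fun i _ => (heval i).mul (hψi i).deriv

section CellData

variable {n : ℕ} {ω : Fin n → MvPolynomial (Fin n) ℂ} {c : ℂ} {ε ρ : ℝ} {ψ : ℂ → (Fin n → ℂ)}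
  {wb wr wt wl : ℝ → ℂ} {P Pu Pv : (Fin 2 → ℝ) → ℂ} {g : ℂ → ℂ}
  (hω : ∀ i, HasAlgCoeffs (ω i)) (hρ : 0 < ρ) (hρε : ρ < ε) (hψ : AnalyticOnNhd ℂ ψ (ball c ε))
  (hψsa : IsSemialgebraicMapOn ℚ {q : Fin 2 → ℝ | (⟨q 0, q 1⟩ : ℂ) ∈ closedBall c ρ}
    (fun q => Fin.append (fun i => (ψ ⟨q 0, q 1⟩ i).re) (fun i => (ψ ⟨q 0, q 1⟩ i).im)))
  (hwb : ContDiffOn ℝ 1 wb (Set.Icc 0 1)) (hwr : ContDiffOn ℝ 1 wr (Set.Icc 0 1))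
  (hwt : ContDiffOn ℝ 1 wt (Set.Icc 0 1)) (hwl : ContDiffOn ℝ 1 wl (Set.Icc 0 1))
  (swb : IsSemialgebraicMapOn ℚ {z : Fin 1 → ℝ | z 0 ∈ Set.Icc (0 : ℝ) 1} (fun z => ![(wb (z 0)).re, (wb (z 0)).im]))
  (swr : IsSemialgebraicMapOn ℚ {z : Fin 1 → ℝ | z 0 ∈ Set.Icc (0 : ℝ) 1} (fun z => ![(wr (z 0)).re, (wr (z 0)).im]))
  (swt : IsSemialgebraicMapOn ℚ {z : Fin 1 → ℝ | z 0 ∈ Set.Icc (0 : ℝ) 1} (fun z => ![(wt (z 0)).re, (wt (z 0)).im]))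
  (swl : IsSemialgebraicMapOn ℚ {z : Fin 1 → ℝ | z 0 ∈ Set.Icc (0 : ℝ) 1} (fun z => ![(wl (z 0)).re, (wl (z 0)).im]))
  (mwb : ∀ t ∈ Set.Icc (0 : ℝ) 1, wb t ∈ closedBall c (ρ / 4))
  (mwr : ∀ t ∈ Set.Icc (0 : ℝ) 1, wr t ∈ closedBall c (ρ / 4))
  (mwt : ∀ t ∈ Set.Icc (0 : ℝ) 1, wt t ∈ closedBall c (ρ / 4))
  (mwl : ∀ t ∈ Set.Icc (0 : ℝ) 1, wl t ∈ closedBall c (ρ / 4))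
  (hP : P = fun p => (1 - (p 1 : ℂ)) * wb (p 0) + (p 1 : ℂ) * wt (p 0) + (1 - (p 0 : ℂ)) * wl (p 1) +
      (p 0 : ℂ) * wr (p 1) -
    ((1 - (p 0 : ℂ)) * (1 - (p 1 : ℂ)) * wb 0 + (p 0 : ℂ) * (1 - (p 1 : ℂ)) * wb 1 +
      (1 - (p 0 : ℂ)) * (p 1 : ℂ) * wt 0 + (p 0 : ℂ) * (p 1 : ℂ) * wt 1))
  (hPu : Pu = fun p => (1 - (p 1 : ℂ)) * derivWithin wb (Set.Icc 0 1) (p 0) +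
      (p 1 : ℂ) * derivWithin wt (Set.Icc 0 1) (p 0) - wl (p 1) + wr (p 1) -
    (-(1 - (p 1 : ℂ)) * wb 0 + (1 - (p 1 : ℂ)) * wb 1 - (p 1 : ℂ) * wt 0 + (p 1 : ℂ) * wt 1))
  (hPv : Pv = fun p => -wb (p 0) + wt (p 0) + (1 - (p 0 : ℂ)) * derivWithin wl (Set.Icc 0 1) (p 1) +
      (p 0 : ℂ) * derivWithin wr (Set.Icc 0 1) (p 1) -
    (-(1 - (p 0 : ℂ)) * wb 0 - (p 0 : ℂ) * wb 1 + (1 - (p 0 : ℂ)) * wt 0 + (p 0 : ℂ) * wt 1))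
  (hg : g = fun w => ∑ i, MvPolynomial.eval (ψ w) (ω i) * deriv (fun u => ψ u i) w)

/-! ## The Coons patch: range, derivative, semialgebraicity, continuity -/

include hρ mwb mwr mwt mwl hP in
/-- The Coons patch maps the closed square into `ball c ρ` (indeed within `3ρ/4` of `c`). [folklore] -/
theorem P_mem_ball {p : Fin 2 → ℝ} (hp : p ∈ {p : Fin 2 → ℝ | 0 ≤ p 0 ∧ p 0 ≤ 1 ∧ 0 ≤ p 1 ∧ p 1 ≤ 1}) : P p ∈ ball c ρ := by
  subst hP
  obtain ⟨h0, h0', h1, h1'⟩ := hp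
  have hb := mwb (p 0) ⟨h0, h0'⟩
  have ht := mwt (p 0) ⟨h0, h0'⟩
  have hl := mwl (p 1) ⟨h1, h1'⟩
  have hr := mwr (p 1) ⟨h1, h1'⟩
  have hb0 := mwb 0 ⟨le_rfl, zero_le_one⟩
  have hb1 := mwb 1 ⟨zero_le_one, le_rfl⟩
  have ht0 := mwt 0 ⟨le_rfl, zero_le_one⟩
  have ht1 := mwt 1 ⟨zero_le_one, le_rfl⟩
  rw [mem_closedBall, dist_eq_norm] at hb ht hl hr hb0 hb1 ht0 ht1
  rw [mem_ball, dist_eq_norm]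
  have key : (1 - (p 1 : ℂ)) * wb (p 0) + (p 1 : ℂ) * wt (p 0) + (1 - (p 0 : ℂ)) * wl (p 1) +
      (p 0 : ℂ) * wr (p 1) -
      ((1 - (p 0 : ℂ)) * (1 - (p 1 : ℂ)) * wb 0 + (p 0 : ℂ) * (1 - (p 1 : ℂ)) * wb 1 +
        (1 - (p 0 : ℂ)) * (p 1 : ℂ) * wt 0 + (p 0 : ℂ) * (p 1 : ℂ) * wt 1) - c =
      ((1 - p 1 : ℝ) : ℂ) * (wb (p 0) - c) + ((p 1 : ℝ) : ℂ) * (wt (p 0) - c) +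
      ((1 - p 0 : ℝ) : ℂ) * (wl (p 1) - c) + ((p 0 : ℝ) : ℂ) * (wr (p 1) - c) -
      ((((1 - p 0) * (1 - p 1) : ℝ) : ℂ) * (wb 0 - c) + ((p 0 * (1 - p 1) : ℝ) : ℂ) * (wb 1 - c) +
        (((1 - p 0) * p 1 : ℝ) : ℂ) * (wt 0 - c) + ((p 0 * p 1 : ℝ) : ℂ) * (wt 1 - c)) := by
    push_cast
    ring
  have nb : ∀ (r : ℝ) (X : ℂ), 0 ≤ r → ‖X‖ ≤ ρ / 4 → ‖(r : ℂ) * X‖ ≤ r * (ρ / 4) := by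
    intro r X hr hX
    rw [norm_mul, Complex.norm_real, Real.norm_of_nonneg hr]
    exact mul_le_mul_of_nonneg_left hX hr
  have n4 : ∀ a b c d : ℂ, ‖a + b + c + d‖ ≤ ‖a‖ + ‖b‖ + ‖c‖ + ‖d‖ := fun a b c d =>
    (norm_add_le _ _).trans (add_le_add norm_add₃_le le_rfl)
  have hsum : (1 - p 1) * (ρ / 4) + p 1 * (ρ / 4) + (1 - p 0) * (ρ / 4) + p 0 * (ρ / 4) +
      ((1 - p 0) * (1 - p 1) * (ρ / 4) + p 0 * (1 - p 1) * (ρ / 4) + (1 - p 0) * p 1 * (ρ / 4) +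
        p 0 * p 1 * (ρ / 4)) = 3 * (ρ / 4) := by ring
  rw [key]
  refine lt_of_le_of_lt ((norm_sub_le _ _).trans (add_le_add
    ((n4 _ _ _ _).trans (add_le_add (add_le_add (add_le_add (nb _ _ (by linarith) hb) (nb _ _ h1 ht))
      (nb _ _ (by linarith) hl)) (nb _ _ h0 hr)))
    ((n4 _ _ _ _).trans (add_le_add (add_le_add (add_le_add (nb _ _ (by nlinarith) hb0)
      (nb _ _ (by nlinarith) hb1)) (nb _ _ (by nlinarith) ht0)) (nb _ _ (by nlinarith) ht1))))) ?_
  rw [hsum]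
  linarith

include hwb hwr hwt hwl hP hPu hPv in
/-- The Fréchet derivative of the Coons patch on the open square: `DP(p) x = x₀ ∂ᵤP(p) + x₁ ∂ᵥP(p)`.
[folklore] -/
theorem P_hasFDerivAt {p : Fin 2 → ℝ} (h0 : p 0 ∈ Set.Ioo (0 : ℝ) 1) (h1 : p 1 ∈ Set.Ioo (0 : ℝ) 1) :
    HasFDerivAt P ((ContinuousLinearMap.proj 0 : (Fin 2 → ℝ) →L[ℝ] ℝ).smulRight (Pu p) +
      (ContinuousLinearMap.proj 1 : (Fin 2 → ℝ) →L[ℝ] ℝ).smulRight (Pv p)) p := by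
  subst hP hPu hPv
  have e0 : HasFDerivAt (fun q : Fin 2 → ℝ => (q 0 : ℂ))
      (Complex.ofRealCLM.comp (ContinuousLinearMap.proj 0)) p :=
    Complex.ofRealCLM.hasFDerivAt.comp p (hasFDerivAt_apply 0 p)
  have e1 : HasFDerivAt (fun q : Fin 2 → ℝ => (q 1 : ℂ))
      (Complex.ofRealCLM.comp (ContinuousLinearMap.proj 1)) p :=
    Complex.ofRealCLM.hasFDerivAt.comp p (hasFDerivAt_apply 1 p)
  have eb : HasFDerivAt (fun q : Fin 2 → ℝ => wb (q 0))
      ((ContinuousLinearMap.smulRight (1 : ℝ →L[ℝ] ℝ) (derivWithin wb (Set.Icc 0 1) (p 0))).comp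
        (ContinuousLinearMap.proj 0)) p :=
    (hasDerivAt_Icc hwb h0).hasFDerivAt.comp p (hasFDerivAt_apply 0 p)
  have et : HasFDerivAt (fun q : Fin 2 → ℝ => wt (q 0))
      ((ContinuousLinearMap.smulRight (1 : ℝ →L[ℝ] ℝ) (derivWithin wt (Set.Icc 0 1) (p 0))).comp
        (ContinuousLinearMap.proj 0)) p :=
    (hasDerivAt_Icc hwt h0).hasFDerivAt.comp p (hasFDerivAt_apply 0 p)
  have el : HasFDerivAt (fun q : Fin 2 → ℝ => wl (q 1))
      ((ContinuousLinearMap.smulRight (1 : ℝ →L[ℝ] ℝ) (derivWithin wl (Set.Icc 0 1) (p 1))).comp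
        (ContinuousLinearMap.proj 1)) p :=
    (hasDerivAt_Icc hwl h1).hasFDerivAt.comp p (hasFDerivAt_apply 1 p)
  have er : HasFDerivAt (fun q : Fin 2 → ℝ => wr (q 1))
      ((ContinuousLinearMap.smulRight (1 : ℝ →L[ℝ] ℝ) (derivWithin wr (Set.Icc 0 1) (p 1))).comp
        (ContinuousLinearMap.proj 1)) p :=
    (hasDerivAt_Icc hwr h1).hasFDerivAt.comp p (hasFDerivAt_apply 1 p)
  have c1 : HasFDerivAt (fun _ : Fin 2 → ℝ => (1 : ℂ)) (0 : (Fin 2 → ℝ) →L[ℝ] ℂ) p :=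
    hasFDerivAt_const _ p
  have cb0 : HasFDerivAt (fun _ : Fin 2 → ℝ => wb 0) (0 : (Fin 2 → ℝ) →L[ℝ] ℂ) p :=
    hasFDerivAt_const _ p
  have cb1 : HasFDerivAt (fun _ : Fin 2 → ℝ => wb 1) (0 : (Fin 2 → ℝ) →L[ℝ] ℂ) p :=
    hasFDerivAt_const _ p
  have ct0 : HasFDerivAt (fun _ : Fin 2 → ℝ => wt 0) (0 : (Fin 2 → ℝ) →L[ℝ] ℂ) p :=
    hasFDerivAt_const _ p
  have ct1 : HasFDerivAt (fun _ : Fin 2 → ℝ => wt 1) (0 : (Fin 2 → ℝ) →L[ℝ] ℂ) p :=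
    hasFDerivAt_const _ p
  have hP := (((((c1.sub e1).mul eb).add (e1.mul et)).add ((c1.sub e0).mul el)).add (e0.mul er)).sub
    ((((((c1.sub e0).mul (c1.sub e1)).mul cb0).add ((e0.mul (c1.sub e1)).mul cb1)).add
      (((c1.sub e0).mul e1).mul ct0)).add ((e0.mul e1).mul ct1))
  refine hP.congr_fderiv (ContinuousLinearMap.ext fun x => ?_)
  simp
  ring

include swb swr swt swl hP in
/-- `re P`, `im P` are `ℚ`-semialgebraic on the closed square. [cite: BochnakCosteRoy1998, Prop. 2.2.6] -/
theorem P_sa : IsSemialgebraicFunOn ℚ {p : Fin 2 → ℝ | 0 ≤ p 0 ∧ p 0 ≤ 1 ∧ 0 ≤ p 1 ∧ p 1 ≤ 1} (fun p => (P p).re) ∧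
    IsSemialgebraicFunOn ℚ {p : Fin 2 → ℝ | 0 ≤ p 0 ∧ p 0 ≤ 1 ∧ 0 ≤ p 1 ∧ p 1 ≤ 1} (fun p => (P p).im) := by
  subst hP
  have h1 := sa_one
  have hx0 := sa_ofReal_coord 0
  have hx1 := sa_ofReal_coord 1
  have hb := sa_path_coord swb 0
  have ht := sa_path_coord swt 0
  have hl := sa_path_coord swl 1
  have hr := sa_path_coord swr 1
  have hb0 := sa_path_zero swb
  have hb1 := sa_path_one swb
  have ht0 := sa_path_zero swt
  have ht1 := sa_path_one swt
  exact re_im_sub (re_im_add (re_im_add (re_im_add (re_im_mul (re_im_sub h1 hx1) hb) (re_im_mul hx1 ht))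
    (re_im_mul (re_im_sub h1 hx0) hl)) (re_im_mul hx0 hr))
    (re_im_add (re_im_add (re_im_add (re_im_mul (re_im_mul (re_im_sub h1 hx0) (re_im_sub h1 hx1)) hb0)
      (re_im_mul (re_im_mul hx0 (re_im_sub h1 hx1)) hb1)) (re_im_mul (re_im_mul (re_im_sub h1 hx0) hx1) ht0))
      (re_im_mul (re_im_mul hx0 hx1) ht1))

include hwb hwt swb swr swt swl hPu in
/-- `re ∂ᵤP`, `im ∂ᵤP` are `ℚ`-semialgebraic on the CLOSED square. [cite: BasuPollackRoy2006, Prop. 3.22] -/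
theorem Pu_sa : IsSemialgebraicFunOn ℚ {p : Fin 2 → ℝ | 0 ≤ p 0 ∧ p 0 ≤ 1 ∧ 0 ≤ p 1 ∧ p 1 ≤ 1} (fun p => (Pu p).re) ∧
    IsSemialgebraicFunOn ℚ {p : Fin 2 → ℝ | 0 ≤ p 0 ∧ p 0 ≤ 1 ∧ 0 ≤ p 1 ∧ p 1 ≤ 1} (fun p => (Pu p).im) := by
  subst hPu
  have h1 := sa_one
  have hx1 := sa_ofReal_coord 1
  have hdb := sa_path_coord (saMap_derivWithin_path hwb swb) 0
  have hdt := sa_path_coord (saMap_derivWithin_path hwt swt) 0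
  have hl := sa_path_coord swl 1
  have hr := sa_path_coord swr 1
  have hb0 := sa_path_zero swb
  have hb1 := sa_path_one swb
  have ht0 := sa_path_zero swt
  have ht1 := sa_path_one swt
  exact re_im_sub (re_im_add (re_im_sub (re_im_add (re_im_mul (re_im_sub h1 hx1) hdb) (re_im_mul hx1 hdt)) hl) hr)
    (re_im_add (re_im_sub (re_im_add (re_im_mul (re_im_neg (re_im_sub h1 hx1)) hb0)
      (re_im_mul (re_im_sub h1 hx1) hb1)) (re_im_mul hx1 ht0)) (re_im_mul hx1 ht1))

include hwr hwl swb swr swt swl hPv in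
/-- `re ∂ᵥP`, `im ∂ᵥP` are `ℚ`-semialgebraic on the CLOSED square. [cite: BasuPollackRoy2006, Prop. 3.22] -/
theorem Pv_sa : IsSemialgebraicFunOn ℚ {p : Fin 2 → ℝ | 0 ≤ p 0 ∧ p 0 ≤ 1 ∧ 0 ≤ p 1 ∧ p 1 ≤ 1} (fun p => (Pv p).re) ∧
    IsSemialgebraicFunOn ℚ {p : Fin 2 → ℝ | 0 ≤ p 0 ∧ p 0 ≤ 1 ∧ 0 ≤ p 1 ∧ p 1 ≤ 1} (fun p => (Pv p).im) := by
  subst hPv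
  have h1 := sa_one
  have hx0 := sa_ofReal_coord 0
  have hb := sa_path_coord swb 0
  have ht := sa_path_coord swt 0
  have hdl := sa_path_coord (saMap_derivWithin_path hwl swl) 1
  have hdr := sa_path_coord (saMap_derivWithin_path hwr swr) 1
  have hb0 := sa_path_zero swb
  have hb1 := sa_path_one swb
  have ht0 := sa_path_zero swt
  have ht1 := sa_path_one swt
  exact re_im_sub (re_im_add (re_im_add (re_im_add (re_im_neg hb) ht) (re_im_mul (re_im_sub h1 hx0) hdl))
    (re_im_mul hx0 hdr))
    (re_im_add (re_im_add (re_im_sub (re_im_mul (re_im_neg (re_im_sub h1 hx0)) hb0) (re_im_mul hx0 hb1))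
      (re_im_mul (re_im_sub h1 hx0) ht0)) (re_im_mul hx0 ht1))

include hwb hwr hwt hwl hP in
/-- The Coons patch is continuous on the closed square. [folklore] -/
theorem P_continuousOn : ContinuousOn P {p : Fin 2 → ℝ | 0 ≤ p 0 ∧ p 0 ≤ 1 ∧ 0 ≤ p 1 ∧ p 1 ≤ 1} := by
  subst hP
  have hb := hwb.continuousOn.comp (continuous_apply 0).continuousOn fun _ hp => coord_mem_Icc 0 hp
  have ht := hwt.continuousOn.comp (continuous_apply 0).continuousOn fun _ hp => coord_mem_Icc 0 hp
  have hl := hwl.continuousOn.comp (continuous_apply 1).continuousOn fun _ hp => coord_mem_Icc 1 hp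
  have hr := hwr.continuousOn.comp (continuous_apply 1).continuousOn fun _ hp => coord_mem_Icc 1 hp
  have e0 : Continuous fun p : Fin 2 → ℝ => (p 0 : ℂ) := Complex.continuous_ofReal.comp (continuous_apply 0)
  have e1 : Continuous fun p : Fin 2 → ℝ => (p 1 : ℂ) := Complex.continuous_ofReal.comp (continuous_apply 1)
  exact ((((((continuousOn_const.sub e1.continuousOn).mul hb).add (e1.continuousOn.mul ht)).add
    ((continuousOn_const.sub e0.continuousOn).mul hl)).add (e0.continuousOn.mul hr)).sub
    ((((((continuousOn_const.sub e0.continuousOn).mul (continuousOn_const.sub e1.continuousOn)).mul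
      continuousOn_const).add ((e0.continuousOn.mul (continuousOn_const.sub e1.continuousOn)).mul
      continuousOn_const)).add (((continuousOn_const.sub e0.continuousOn).mul e1.continuousOn).mul
      continuousOn_const)).add ((e0.continuousOn.mul e1.continuousOn).mul continuousOn_const)))

include hwb hwr hwt hwl hPu in
/-- `∂ᵤP` is continuous on the closed square. [folklore] -/
theorem Pu_continuousOn : ContinuousOn Pu {p : Fin 2 → ℝ | 0 ≤ p 0 ∧ p 0 ≤ 1 ∧ 0 ≤ p 1 ∧ p 1 ≤ 1} := by
  subst hPu
  have hdb := (hwb.continuousOn_derivWithin (uniqueDiffOn_Icc zero_lt_one) le_rfl).comp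
    (continuous_apply 0).continuousOn fun _ hp => coord_mem_Icc 0 hp
  have hdt := (hwt.continuousOn_derivWithin (uniqueDiffOn_Icc zero_lt_one) le_rfl).comp
    (continuous_apply 0).continuousOn fun _ hp => coord_mem_Icc 0 hp
  have hl := hwl.continuousOn.comp (continuous_apply 1).continuousOn fun _ hp => coord_mem_Icc 1 hp
  have hr := hwr.continuousOn.comp (continuous_apply 1).continuousOn fun _ hp => coord_mem_Icc 1 hp
  have e1 : Continuous fun p : Fin 2 → ℝ => (p 1 : ℂ) := Complex.continuous_ofReal.comp (continuous_apply 1)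
  exact ((((continuousOn_const.sub e1.continuousOn).mul hdb).add (e1.continuousOn.mul hdt)).sub hl).add hr
    |>.sub (((((continuousOn_const.sub e1.continuousOn).neg.mul continuousOn_const).add
      ((continuousOn_const.sub e1.continuousOn).mul continuousOn_const)).sub
      (e1.continuousOn.mul continuousOn_const)).add (e1.continuousOn.mul continuousOn_const))

include hwb hwr hwt hwl hPv in
/-- `∂ᵥP` is continuous on the closed square. [folklore] -/
theorem Pv_continuousOn : ContinuousOn Pv {p : Fin 2 → ℝ | 0 ≤ p 0 ∧ p 0 ≤ 1 ∧ 0 ≤ p 1 ∧ p 1 ≤ 1} := by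
  subst hPv
  have hb := hwb.continuousOn.comp (continuous_apply 0).continuousOn fun _ hp => coord_mem_Icc 0 hp
  have ht := hwt.continuousOn.comp (continuous_apply 0).continuousOn fun _ hp => coord_mem_Icc 0 hp
  have hdl := (hwl.continuousOn_derivWithin (uniqueDiffOn_Icc zero_lt_one) le_rfl).comp
    (continuous_apply 1).continuousOn fun _ hp => coord_mem_Icc 1 hp
  have hdr := (hwr.continuousOn_derivWithin (uniqueDiffOn_Icc zero_lt_one) le_rfl).comp
    (continuous_apply 1).continuousOn fun _ hp => coord_mem_Icc 1 hp
  have e0 : Continuous fun p : Fin 2 → ℝ => (p 0 : ℂ) := Complex.continuous_ofReal.comp (continuous_apply 0)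
  exact (((hb.neg.add ht).add ((continuousOn_const.sub e0.continuousOn).mul hdl)).add
    (e0.continuousOn.mul hdr)).sub
    (((((continuousOn_const.sub e0.continuousOn).neg.mul continuousOn_const).sub
      (e0.continuousOn.mul continuousOn_const)).add
      ((continuousOn_const.sub e0.continuousOn).mul continuousOn_const)).add
      (e0.continuousOn.mul continuousOn_const))

/-! ## The chart along the patch -/

include hψsa in
/-- The realified closed chart disc is `ℚ`-semialgebraic. [cite: BochnakCosteRoy1998, Thm. 2.2.1] -/
theorem disc_sa : IsSemialgebraic ℚ {q : Fin 2 → ℝ | (⟨q 0, q 1⟩ : ℂ) ∈ closedBall c ρ} :=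
  IsSemialgebraicMapOn.isSemialgebraic_holds hψsa

include hψsa in
/-- `re ψᵢ` is `ℚ`-semialgebraic on the realified closed disc. [cite: BochnakCosteRoy1998, §2.2] -/
theorem ψ_re_sa (i : Fin n) : IsSemialgebraicFunOn ℚ {q : Fin 2 → ℝ | (⟨q 0, q 1⟩ : ℂ) ∈ closedBall c ρ} (fun q => (ψ ⟨q 0, q 1⟩ i).re) := by
  refine ((isSemialgebraicMapOn_iff_forall_holds (disc_sa hψsa)).mp hψsa (Fin.castAdd n i)).congr
    fun q _ => ?_
  simp only [Fin.append_left]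

include hψsa in
/-- `im ψᵢ` is `ℚ`-semialgebraic on the realified closed disc. [cite: BochnakCosteRoy1998, §2.2] -/
theorem ψ_im_sa (i : Fin n) : IsSemialgebraicFunOn ℚ {q : Fin 2 → ℝ | (⟨q 0, q 1⟩ : ℂ) ∈ closedBall c ρ} (fun q => (ψ ⟨q 0, q 1⟩ i).im) := by
  refine ((isSemialgebraicMapOn_iff_forall_holds (disc_sa hψsa)).mp hψsa (Fin.natAdd n i)).congr
    fun q _ => ?_
  simp only [Fin.append_right]

include hρ mwb mwr mwt mwl hP in
/-- The realified patch lands in the INTERIOR of the realified disc. [folklore] -/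
theorem reP_mem_interior {p : Fin 2 → ℝ} (hp : p ∈ {p : Fin 2 → ℝ | 0 ≤ p 0 ∧ p 0 ≤ 1 ∧ 0 ≤ p 1 ∧ p 1 ≤ 1}) :
    ![(P p).re, (P p).im] ∈ interior {q : Fin 2 → ℝ | (⟨q 0, q 1⟩ : ℂ) ∈ closedBall c ρ} := by
  have hθ : Continuous fun q : Fin 2 → ℝ => (⟨q 0, q 1⟩ : ℂ) := by
    have : (fun q : Fin 2 → ℝ => (⟨q 0, q 1⟩ : ℂ)) = fun q => (q 0 : ℂ) + (q 1 : ℂ) * Complex.I :=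
      funext fun q => Complex.mk_eq_add_mul_I _ _
    rw [this]
    fun_prop
  have hmem : (fun q : Fin 2 → ℝ => (⟨q 0, q 1⟩ : ℂ)) ![(P p).re, (P p).im] ∈
      interior (closedBall c ρ) := by
    apply ball_subset_interior_closedBall
    show (⟨(P p).re, (P p).im⟩ : ℂ) ∈ ball c ρ
    rw [Complex.eta]
    exact P_mem_ball hρ mwb mwr mwt mwl hP hp
  exact preimage_interior_subset_interior_preimage hθ hmem

include swb swr swt swl hP in
/-- The realified patch is a `ℚ`-semialgebraic map on the square. [cite: BochnakCosteRoy1998, §2.2] -/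
theorem reP_saMap : IsSemialgebraicMapOn ℚ {p : Fin 2 → ℝ | 0 ≤ p 0 ∧ p 0 ≤ 1 ∧ 0 ≤ p 1 ∧ p 1 ≤ 1} (fun p => ![(P p).re, (P p).im]) :=
  (saMap_iff isSemialgebraic_csq).mpr (P_sa swb swr swt swl hP)

include hρ hψsa swb swr swt swl mwb mwr mwt mwl hP in
/-- `ψᵢ ∘ P` has `ℚ`-semialgebraic real and imaginary parts on the square.
[cite: BochnakCosteRoy1998, Prop. 2.2.6] -/
theorem ψP_sa (i : Fin n) :
    IsSemialgebraicFunOn ℚ {p : Fin 2 → ℝ | 0 ≤ p 0 ∧ p 0 ≤ 1 ∧ 0 ≤ p 1 ∧ p 1 ≤ 1} (fun p => (ψ (P p) i).re) ∧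
      IsSemialgebraicFunOn ℚ {p : Fin 2 → ℝ | 0 ≤ p 0 ∧ p 0 ≤ 1 ∧ 0 ≤ p 1 ∧ p 1 ≤ 1} (fun p => (ψ (P p) i).im) := by
  have hmaps : MapsTo (fun p => ![(P p).re, (P p).im]) {p : Fin 2 → ℝ | 0 ≤ p 0 ∧ p 0 ≤ 1 ∧ 0 ≤ p 1 ∧ p 1 ≤ 1}
      {q : Fin 2 → ℝ | (⟨q 0, q 1⟩ : ℂ) ∈ closedBall c ρ} :=
    fun p hp => interior_subset (reP_mem_interior hρ mwb mwr mwt mwl hP hp)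
  have hm := reP_saMap swb swr swt swl hP
  refine ⟨(IsSemialgebraicFunOn.comp_isSemialgebraicMapOn_holds (ψ_re_sa hψsa i) hm hmaps).congr
    fun p _ => ?_, (IsSemialgebraicFunOn.comp_isSemialgebraicMapOn_holds (ψ_im_sa hψsa i) hm
    hmaps).congr fun p _ => ?_⟩ <;> simp

include hρ hρε hψ hψsa swb swr swt swl mwb mwr mwt mwl hP in
/-- `ψᵢ′ ∘ P` has `ℚ`-semialgebraic real and imaginary parts on the square.
[cite: BasuPollackRoy2006, Prop. 3.22] -/
theorem dψP_sa (i : Fin n) :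
    IsSemialgebraicFunOn ℚ {p : Fin 2 → ℝ | 0 ≤ p 0 ∧ p 0 ≤ 1 ∧ 0 ≤ p 1 ∧ p 1 ≤ 1}
        (fun p => (deriv (fun u => ψ u i) (P p)).re) ∧
      IsSemialgebraicFunOn ℚ {p : Fin 2 → ℝ | 0 ≤ p 0 ∧ p 0 ≤ 1 ∧ 0 ≤ p 1 ∧ p 1 ≤ 1}
        (fun p => (deriv (fun u => ψ u i) (P p)).im) := by
  have hmaps : MapsTo (fun p => ![(P p).re, (P p).im]) {p : Fin 2 → ℝ | 0 ≤ p 0 ∧ p 0 ≤ 1 ∧ 0 ≤ p 1 ∧ p 1 ≤ 1}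
      (interior {q : Fin 2 → ℝ | (⟨q 0, q 1⟩ : ℂ) ∈ closedBall c ρ}) :=
    fun p hp => reP_mem_interior hρ mwb mwr mwt mwl hP hp
  have hm := reP_saMap swb swr swt swl hP
  have hre := sa_deriv_chart hρε hψ i Complex.reCLM (by simpa using ψ_re_sa hψsa i)
  have him := sa_deriv_chart hρε hψ i Complex.imCLM (by simpa using ψ_im_sa hψsa i)
  refine ⟨(IsSemialgebraicFunOn.comp_isSemialgebraicMapOn_holds hre hm hmaps).congr
    fun p _ => ?_, (IsSemialgebraicFunOn.comp_isSemialgebraicMapOn_holds him hm hmaps).congr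
    fun p _ => ?_⟩ <;> simp

include hω hρ hρε hψ hψsa swb swr swt swl mwb mwr mwt mwl hP hg in
/-- `g ∘ P` has `ℚ`-semialgebraic real and imaginary parts on the square, `g = Σᵢ ωᵢ(ψ) ψᵢ′` the density of the
pulled-back form. [cite: BochnakCosteRoy1998, Prop. 2.2.6] -/
theorem gP_sa : IsSemialgebraicFunOn ℚ {p : Fin 2 → ℝ | 0 ≤ p 0 ∧ p 0 ≤ 1 ∧ 0 ≤ p 1 ∧ p 1 ≤ 1} (fun p => (g (P p)).re) ∧
    IsSemialgebraicFunOn ℚ {p : Fin 2 → ℝ | 0 ≤ p 0 ∧ p 0 ≤ 1 ∧ 0 ≤ p 1 ∧ p 1 ≤ 1} (fun p => (g (P p)).im) := by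
  subst hg
  exact re_im_finsetSum isSemialgebraic_csq _ fun i _ =>
    re_im_mul (re_im_eval isSemialgebraic_csq (F := fun p => ψ (P p))
      (ψP_sa hρ hψsa swb swr swt swl mwb mwr mwt mwl hP) (hω i))
      (dψP_sa hρ hρε hψ hψsa swb swr swt swl mwb mwr mwt mwl hP i)

end CellData

end Summit.KontsevichZagierPeriods.SymplecticScissors.RealOnePeriodRelations.CellGreen

namespace Summit.KontsevichZagierPeriods.SymplecticScissors.RealOnePeriodRelations

/-- **Registered anchor `helper_cellGreen_2` (THE PULLED-BACK DENSITY IS HOLOMORPHIC).** For a chart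
`ψ : ℂ → ℂⁿ` holomorphic on `ball c ε` and a polynomial `1`-form `Σ ωᵢ dxᵢ`, the density
`g(w) = Σᵢ ωᵢ(ψ(w)) ψᵢ′(w)` of `ψ^*ω = g(w) dw` is holomorphic on `ball c ε` (so it has a primitive there,
`DifferentiableOn.isExactOn_ball`). [folklore] -/
theorem helper_cellGreen_2 : ∀ (n : ℕ) (ω : Fin n → MvPolynomial (Fin n) ℂ) (c : ℂ) (ε : ℝ) (ψ : ℂ → (Fin n → ℂ)), AnalyticOnNhd ℂ ψ (Metric.ball c ε) → AnalyticOnNhd ℂ (fun w => ∑ i, MvPolynomial.eval (ψ w) (ω i) * deriv (fun u => ψ u i) w) (Metric.ball c ε) :=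
  fun _ ω _ _ _ hψ => CellGreen.analyticOnNhd_density ω hψ

end Summit.KontsevichZagierPeriods.SymplecticScissors.RealOnePeriodRelations

end
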